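import Mathlib
import Literature.AlgebraicGeometry.Resolution.TotallyPreparedCompletion
import Literature.AlgebraicGeometry.Resolution.CompletedChainTransfer
import Literature.AlgebraicGeometry.Resolution.PreparednessTransport
import Literature.AlgebraicGeometry.Resolution.PointBlowupPolygonLaws
import Literature.AlgebraicGeometry.Resolution.AdaptedOfPrepared
import Literature.AlgebraicGeometry.Resolution.RsopAdaptedShift
import Literature.AlgebraicGeometry.Resolution.InitialFormsChangeOfParameters
import HarnessLib

/-!
# The point step of the transport down the completed chain (`τ = 1` endgame, brick B5-pt)

Topic: `Literature/AlgebraicGeometry/Resolution`. V. Cossart, U. Jannsen, S. Saito, LNM 2270 (2020),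
Lemma 13.2 (1) and proof of Thm. 13.7 / Claim 13.8 [cite: CossartJannsenSaito2020, Lemma 13.2];
V. Cossart, O. Piltant, J. Algebra 320 (2008), Lemma 4.5 (2) and proof of Prop. 4.4 p. 11
[cite: CossartPiltant2008, Lemma 4.5]; H. Matsumura, *Commutative Ring Theory*, §8 [cite: Matsumura1987, Thm. 8.11].

OURS (brick B5-pt of the N2 assembly, architecture (B)): ONE POINT STEP of the transport of the prepared
adapted system `x = (ŷ, u, ŵ)` of `R̂` down a rational `u`-chart point step `φ : R → R'` whose near point is
described, for every adapted label of `R`, by the contract clause `hpoint`, and which is the ORIGIN for the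
shear-lifted third parameter (`φ w = φ u · w₊`, `(y₊, φ u, w₊) = 𝔪'`, B3): the transported system
`x' = (ŷ', φ u, ŵ')` of `R̂'` (`φ̂ ŷ = φ̂ u · ŷ'`, `φ̂ ŵ = φ̂ u · ŵ'`) generates `𝔪̂'`, is prepared at every
vertex, adapted (`L < δs`), with non-empty polygon and a monic element, and the `𝔪`-adic approximation of
`ŵ` by the shear-lifted parameters loses one order. Also: a monic element from adaptedness
(`hasMonic_of_lt_deltaS`). F-71 / T1 / N2 NOT proved; no summit statement is proved.
-/

noncomputable section

open IsLocalRing MvPolynomial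

namespace Literature.AlgebraicGeometry.Resolution

universe u

/-! ## Small tools -/

section Tools

variable {S : Type u} [CommRing S]

/-- `(a + s b, b, d + t b) = (a, b, d)` as ideals. [folklore] -/
private theorem span_triple_shear_eq (a b d s t : S) :
    Ideal.span ({a + s * b, b, d + t * b} : Set S) = Ideal.span {a, b, d} := by
  apply le_antisymm
  · rw [Ideal.span_le, Set.insert_subset_iff, Set.insert_subset_iff, Set.singleton_subset_iff]
    refine ⟨?_, ?_, ?_⟩
    · exact Ideal.add_mem _ (Ideal.subset_span (by simp))
        (Ideal.mul_mem_left _ _ (Ideal.subset_span (by simp)))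
    · exact Ideal.subset_span (by simp)
    · exact Ideal.add_mem _ (Ideal.subset_span (by simp))
        (Ideal.mul_mem_left _ _ (Ideal.subset_span (by simp)))
  · rw [Ideal.span_le, Set.insert_subset_iff, Set.insert_subset_iff, Set.singleton_subset_iff]
    have hb : b ∈ Ideal.span ({a + s * b, b, d + t * b} : Set S) := Ideal.subset_span (by simp)
    refine ⟨?_, hb, ?_⟩
    · have h1 : a + s * b ∈ Ideal.span ({a + s * b, b, d + t * b} : Set S) := Ideal.subset_span (by simp)
      have h := Ideal.sub_mem _ h1 (Ideal.mul_mem_left _ s hb)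
      rwa [add_sub_cancel_right] at h
    · have h1 : d + t * b ∈ Ideal.span ({a + s * b, b, d + t * b} : Set S) := Ideal.subset_span (by simp)
      have h := Ideal.sub_mem _ h1 (Ideal.mul_mem_left _ t hb)
      rwa [add_sub_cancel_right] at h

variable [IsRegularLocalRing S]

/-- A member of a regular system of parameters of a three-dimensional regular local ring is non-zero.
[folklore] -/
private theorem ne_zero_of_span_triple {a b d : S} (hdim : ringKrullDim S = 3)
    (h : Ideal.span ({a, b, d} : Set S) = maximalIdeal S) : b ≠ 0 := by
  intro hb
  have hfr : (maximalIdeal S).spanFinrank = 3 := by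
    have h := IsRegularLocalRing.spanFinrank_maximalIdeal (R := S)
    rw [hdim] at h
    exact_mod_cast h
  have heq : Ideal.span ({a, d} : Set S) = maximalIdeal S := by
    rw [← h, hb]
    apply le_antisymm
    · exact Ideal.span_mono (by intro x hx; rcases hx with rfl | rfl <;> simp)
    · rw [Ideal.span_le, Set.insert_subset_iff, Set.insert_subset_iff, Set.singleton_subset_iff]
      exact ⟨Ideal.subset_span (by simp), Ideal.zero_mem _, Ideal.subset_span (by simp)⟩
  have hfin : ({a, d} : Set S).Finite := Set.toFinite _
  have hle : (Ideal.span ({a, d} : Set S)).spanFinrank ≤ ({a, d} : Set S).ncard :=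
    Submodule.spanFinrank_span_le_ncard_of_finite hfin
  have hcard : ({a, d} : Set S).ncard ≤ 2 := (Set.ncard_insert_le _ _).trans (by rw [Set.ncard_singleton])
  rw [heq, hfr] at hle
  omega

/-- Every element of `R̂` is congruent to an element of `R` modulo `𝔪̂ⁿ` (density). [cite: Matsumura1987, §8 (Thm. 8.10)] -/
theorem exists_sub_algebraMap_mem_pow_adicCompletion (x : AdicCompletion (maximalIdeal S) S) (n : ℕ) :
    ∃ a : S, x - algebraMap S (AdicCompletion (maximalIdeal S) S) a ∈
      maximalIdeal (AdicCompletion (maximalIdeal S) S) ^ n := by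
  obtain ⟨a, ha⟩ := Ideal.Quotient.mk_surjective (AdicCompletion.evalₐ (maximalIdeal S) n x)
  refine ⟨a, ?_⟩
  rw [AdicCompletion.maximalIdeal_eq_map]
  exact AdicCompletion.sub_of_mem_pow_map_of_evalₐ_eq (maximalIdeal S)
    (maximalIdeal S).fg_of_isNoetherianRing x a ha.symm

variable (c : Fin 3 → S) (hgen : Ideal.span {c 0, c 1, c 2} = maximalIdeal S) (hdim : ringKrullDim S = 3)
  {J : Ideal S} {μ : ℕ}

include hgen hdim in
/-- **A monic element from adaptedness**: if `J ⊆ 𝔪^μ`, `J ⊄ 𝔪^{μ+1}` and `L < δs` then some `in_μ(g)`,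
`g ∈ J`, has a non-zero `Y^μ`-coefficient. [cite: CossartPiltant2008, (10)] [cite: CossartJannsenSaito2020, (12.1)] -/
theorem hasMonic_of_lt_deltaS (hJμ : J ≤ maximalIdeal S ^ μ) (hJne : ¬ J ≤ maximalIdeal S ^ (μ + 1))
    (hδ : μ.factorial < deltaS c J μ) : HasMonic c J μ := by
  classical
  have hgenr := span_range_eq_of_span_triple c hgen
  have h1 : ∀ i, 0 < (fun _ : Fin 3 => (1 : ℕ)) i := fun _ => Nat.one_pos
  obtain ⟨g, hgJ, hg⟩ := SetLike.not_le_iff_exists.mp hJne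
  obtain ⟨f, hfu, hgf⟩ := exists_monic_of_lt_deltaS c hgen hdim hJμ hδ hgJ hg
  refine ⟨g, hgJ, ?_⟩
  have hin : IsInForm c (fun _ => 1) μ g (C (residue S f) * X 0 ^ μ) := by
    refine ⟨C f * X 0 ^ μ, ?_, by rw [map_mul, map_C, map_pow, map_X], ?_⟩
    · rw [isWeightedHomogeneous_one_iff]
      have := (isHomogeneous_C (Fin 3) f).mul (isHomogeneous_X_pow (0 : Fin 3) μ)
      rwa [zero_add] at this
    · rw [weightedIdealW_one_eq_pow c hgenr, map_mul, eval_C, map_pow, eval_X]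
      exact hgf
  rw [← hin.eq_inForm c hgen hdim h1, coeff_C_mul, coeff_X_pow, if_pos rfl, mul_one]
  intro h0
  rw [residue_eq_zero_iff] at h0
  exact (mem_maximalIdeal _).mp h0 hfu

end Tools

/-! ## The point step -/

section PointStep

variable {R R' : Type u} [CommRing R] [CommRing R'] [IsRegularLocalRing R] [IsRegularLocalRing R']
  (φ : R →+* R') [IsLocalHom φ] (hφm : (maximalIdeal R).map φ ≤ maximalIdeal R')
  (hdim : ringKrullDim R = 3) (hdim' : ringKrullDim R' = 3)

include hdim hdim' in
/-- **B5-pt (OURS). The point step of the transport down the completed chain.** See the module docstring.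
[cite: CossartJannsenSaito2020, Lemma 13.2 (1), Thm. 13.7 (proof)] [cite: CossartPiltant2008, Lemma 4.5 (2)]
[cite: Matsumura1987, Thm. 8.11] -/
theorem completedChain_point_step
    (hres : Function.Surjective (ResidueField.map φ))
    {I : Ideal R} {I' : Ideal R'} {μ : ℕ} (u : R)
    (hIμ : I ≤ maximalIdeal R ^ μ) (hIne : ¬ I ≤ maximalIdeal R ^ (μ + 1))
    (hIμ' : I' ≤ maximalIdeal R' ^ μ) (hIne' : ¬ I' ≤ maximalIdeal R' ^ (μ + 1))
    (hI : I' = (I.map φ).colon {φ u ^ μ})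
    (hτ' : ∀ c' : Fin 3 → R', Ideal.span {c' 0, c' 1, c' 2} = maximalIdeal R' → hironakaTauAt c' I' μ = 1)
    (hpoint : ∀ (y w : R), Ideal.span {y, u, w} = maximalIdeal R →
      (∀ G ∈ initialForms ![y, u, w] I μ, ∃ a : ResidueField R, G = C a * X 0 ^ μ) →
      ∃ (a : R) (y' w' : R'), φ y = φ u * y' ∧ φ (w - a * u) = φ u * w' ∧
        Ideal.span {y', φ u, w'} = maximalIdeal R')
    [IsRegularLocalRing (AdicCompletion (maximalIdeal R) R)] [IsRegularLocalRing (AdicCompletion (maximalIdeal R') R')]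
    (x : Fin 3 → (AdicCompletion (maximalIdeal R) R)) (hx1 : x 1 = (algebraMap R (AdicCompletion (maximalIdeal R) R)) u)
    (hgenx : Ideal.span {x 0, x 1, x 2} = maximalIdeal (AdicCompletion (maximalIdeal R) R))
    (hprep : ∀ B, PreparedUpTo x (I.map (algebraMap R (AdicCompletion (maximalIdeal R) R))) μ B)
    (hne : (pts x (I.map (algebraMap R (AdicCompletion (maximalIdeal R) R))) μ).Nonempty)
    (hδ : μ.factorial < deltaS x (I.map (algebraMap R (AdicCompletion (maximalIdeal R) R))) μ)
    (w : R) (hw : x 2 - (algebraMap R (AdicCompletion (maximalIdeal R) R)) w ∈ maximalIdeal (AdicCompletion (maximalIdeal R) R) ^ 2)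
    (wplus : R') (hww : φ w = φ u * wplus) (hgenplus : ∃ yplus : R', Ideal.span {yplus, φ u, wplus} = maximalIdeal R') :
    ∃ x' : Fin 3 → (AdicCompletion (maximalIdeal R') R'),
      x' 1 = (algebraMap R' (AdicCompletion (maximalIdeal R') R')) (φ u) ∧
      Ideal.span {x' 0, x' 1, x' 2} = maximalIdeal (AdicCompletion (maximalIdeal R') R') ∧
      (adicCompletionMap (maximalIdeal R) (maximalIdeal R') φ hφm) (x 0) = (adicCompletionMap (maximalIdeal R) (maximalIdeal R') φ hφm) (x 1) * x' 0 ∧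
      (adicCompletionMap (maximalIdeal R) (maximalIdeal R') φ hφm) (x 2) = (adicCompletionMap (maximalIdeal R) (maximalIdeal R') φ hφm) (x 1) * x' 2 ∧
      (∀ B, PreparedUpTo x' (I'.map (algebraMap R' (AdicCompletion (maximalIdeal R') R'))) μ B) ∧
      (pts x' (I'.map (algebraMap R' (AdicCompletion (maximalIdeal R') R'))) μ).Nonempty ∧
      μ.factorial < deltaS x' (I'.map (algebraMap R' (AdicCompletion (maximalIdeal R') R'))) μ ∧
      HasMonic x' (I'.map (algebraMap R' (AdicCompletion (maximalIdeal R') R'))) μ ∧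
      (∀ (w₁ : R) (w₁' : R') (k : ℕ), φ w₁ = φ u * w₁' →
        x 2 - (algebraMap R (AdicCompletion (maximalIdeal R) R)) w₁ ∈ maximalIdeal (AdicCompletion (maximalIdeal R) R) ^ (k + 1) →
        x' 2 - (algebraMap R' (AdicCompletion (maximalIdeal R') R')) w₁' ∈ maximalIdeal (AdicCompletion (maximalIdeal R') R') ^ k) := by
  classical
  have hL := Nat.factorial_pos μ
  have hdimA : ringKrullDim (AdicCompletion (maximalIdeal R) R) = 3 := by rw [ringKrullDim_adicCompletion, hdim]
  have hdimB : ringKrullDim (AdicCompletion (maximalIdeal R') R') = 3 := by rw [ringKrullDim_adicCompletion, hdim']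
  have hfrA : (maximalIdeal (AdicCompletion (maximalIdeal R) R)).spanFinrank = 3 := by
    have h := IsRegularLocalRing.spanFinrank_maximalIdeal (R := (AdicCompletion (maximalIdeal R) R))
    rw [hdimA] at h
    exact_mod_cast h
  have hfrB : (maximalIdeal (AdicCompletion (maximalIdeal R') R')).spanFinrank = 3 := by
    have h := IsRegularLocalRing.spanFinrank_maximalIdeal (R := (AdicCompletion (maximalIdeal R') R'))
    rw [hdimB] at h
    exact_mod_cast h
  haveI hφHloc : IsLocalHom (adicCompletionMap (maximalIdeal R) (maximalIdeal R') φ hφm) := isLocalHom_adicCompletionMap' φ hφm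
  haveI : IsDomain R' := isDomain_of_isRegularLocalRing R'
  haveI : IsDomain (AdicCompletion (maximalIdeal R') R') := isDomain_of_isRegularLocalRing _
  have hψ := residueField_map_adicCompletionMap_surjective φ hφm hres
  have hmA : maximalIdeal (AdicCompletion (maximalIdeal R) R) = (maximalIdeal R).map (algebraMap R (AdicCompletion (maximalIdeal R) R)) := AdicCompletion.maximalIdeal_eq_map
  have hmB : maximalIdeal (AdicCompletion (maximalIdeal R') R') = (maximalIdeal R').map (algebraMap R' (AdicCompletion (maximalIdeal R') R')) := AdicCompletion.maximalIdeal_eq_map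
  have hIμA : I.map (algebraMap R (AdicCompletion (maximalIdeal R) R)) ≤ maximalIdeal (AdicCompletion (maximalIdeal R) R) ^ μ := map_le_pow_maximalIdeal_adicCompletion hIμ
  have hIneA : ¬ I.map (algebraMap R (AdicCompletion (maximalIdeal R) R)) ≤ maximalIdeal (AdicCompletion (maximalIdeal R) R) ^ (μ + 1) := not_map_le_pow_maximalIdeal_adicCompletion hIne
  have hIμB : I'.map (algebraMap R' (AdicCompletion (maximalIdeal R') R')) ≤ maximalIdeal (AdicCompletion (maximalIdeal R') R') ^ μ := map_le_pow_maximalIdeal_adicCompletion hIμ'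
  have hIneB : ¬ I'.map (algebraMap R' (AdicCompletion (maximalIdeal R') R')) ≤ maximalIdeal (AdicCompletion (maximalIdeal R') R') ^ (μ + 1) := not_map_le_pow_maximalIdeal_adicCompletion hIne'
  have hgenxr := span_range_eq_of_span_triple x hgenx
  -- (A) an `R`-approximation `l` of `ŷ`; the label `(l, u, w)` of `R`
  obtain ⟨l, hl⟩ := exists_sub_algebraMap_mem_pow_adicCompletion (x 0) 2
  set cR : Fin 3 → R := ![l, u, w] with hcR
  have hdiff : ∀ i, (algebraMap R (AdicCompletion (maximalIdeal R) R)) (cR i) - x i ∈ maximalIdeal (AdicCompletion (maximalIdeal R) R) ^ 2 := by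
    intro i
    fin_cases i
    · show (algebraMap R (AdicCompletion (maximalIdeal R) R)) l - x 0 ∈ _
      rw [← neg_sub, Ideal.neg_mem_iff]; exact hl
    · show (algebraMap R (AdicCompletion (maximalIdeal R) R)) u - x 1 ∈ _
      rw [hx1, sub_self]; exact Ideal.zero_mem _
    · show (algebraMap R (AdicCompletion (maximalIdeal R) R)) w - x 2 ∈ _
      rw [← neg_sub, Ideal.neg_mem_iff]; exact hw
  have hgenιr : Ideal.span (Set.range (fun i => (algebraMap R (AdicCompletion (maximalIdeal R) R)) (cR i))) = maximalIdeal (AdicCompletion (maximalIdeal R) R) :=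
    span_range_eq_of_sub_mem_sq hgenxr hdiff
  have hgenι : Ideal.span {(algebraMap R (AdicCompletion (maximalIdeal R) R)) (cR 0), (algebraMap R (AdicCompletion (maximalIdeal R) R)) (cR 1), (algebraMap R (AdicCompletion (maximalIdeal R) R)) (cR 2)} = maximalIdeal (AdicCompletion (maximalIdeal R) R) := by
    rw [← hgenιr]; congr 1; ext z
    simp only [Set.mem_insert_iff, Set.mem_singleton_iff, Set.mem_range]
    constructor
    · rintro (rfl | rfl | rfl)
      exacts [⟨0, rfl⟩, ⟨1, rfl⟩, ⟨2, rfl⟩]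
    · rintro ⟨i, rfl⟩; fin_cases i <;> simp
  -- the label generates `𝔪` (faithful flatness of `R → R̂`)
  haveI : Module.FaithfullyFlat R (AdicCompletion (maximalIdeal R) R) := Module.FaithfullyFlat.of_flat_of_isLocalHom
  have hgenR : Ideal.span {cR 0, cR 1, cR 2} = maximalIdeal R := by
    have h1 : (Ideal.span ({cR 0, cR 1, cR 2} : Set R)).map (algebraMap R (AdicCompletion (maximalIdeal R) R)) = (maximalIdeal R).map (algebraMap R (AdicCompletion (maximalIdeal R) R)) := by
      rw [Ideal.map_span, Set.image_insert_eq, Set.image_insert_eq, Set.image_singleton, hgenι, hmA]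
    have h2 := congrArg (Ideal.comap (algebraMap R (AdicCompletion (maximalIdeal R) R))) h1
    rwa [Ideal.comap_map_eq_self_of_faithfullyFlat, Ideal.comap_map_eq_self_of_faithfullyFlat] at h2
  -- (B) the label is adapted: `cl_μ` of `x` = `cl_μ` of `ι ∘ cR` (same modulo `𝔪̂²`), then descend
  have hadx := forall_initialForms_of_lt_deltaS x hgenx hdimA hIμA hδ
  have hformsι : ∀ G ∈ initialForms (fun i => (algebraMap R (AdicCompletion (maximalIdeal R) R)) (cR i)) (I.map (algebraMap R (AdicCompletion (maximalIdeal R) R))) μ,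
      ∃ a : ResidueField (AdicCompletion (maximalIdeal R) R), G = C a * X 0 ^ μ := by
    intro G hG
    rw [initialForms_eq_of_sub_mem_sq hfrA hgenxr hdiff] at hG
    exact hadx G hG
  have hadR : ∀ G ∈ initialForms cR I μ, ∃ a : ResidueField R, G = C a * X 0 ^ μ := by
    intro G hG
    have hbij := AdicCompletion.residueField_map_bijective R
    have hmem : MvPolynomial.map (ResidueField.map (algebraMap R (AdicCompletion (maximalIdeal R) R))) G ∈
        initialForms (fun i => (algebraMap R (AdicCompletion (maximalIdeal R) R)) (cR i)) (I.map (algebraMap R (AdicCompletion (maximalIdeal R) R))) μ :=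
      (mem_initialForms_map_adicCompletion_iff cR hgenR hdim hIμ _).mpr ⟨G, hG, rfl⟩
    obtain ⟨a, ha⟩ := hformsι _ hmem
    obtain ⟨a₀, rfl⟩ := hbij.2 a
    refine ⟨a₀, MvPolynomial.map_injective _ hbij.1 ?_⟩
    rw [ha, map_mul, map_C, map_pow, map_X]
  -- (C) the contract's point step on the label
  obtain ⟨a, l', w', hl', hw', hgen'⟩ := hpoint l w hgenR hadR
  have hu0 : φ u ≠ 0 := ne_zero_of_span_triple hdim' hgen'
  have hwplus : wplus = w' + φ a := by
    have h1 : φ u * (wplus - (w' + φ a)) = 0 := by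
      rw [map_sub, map_mul] at hw'
      rw [mul_sub, ← hww, mul_add, ← hw']; ring
    rcases mul_eq_zero.mp h1 with h | h
    · exact absurd h hu0
    · exact (sub_eq_zero.mp h)
  obtain ⟨yplus, hgenp⟩ := hgenplus
  have hwplusm : wplus ∈ maximalIdeal R' := hgenp ▸ Ideal.subset_span (by simp)
  have hw'm : w' ∈ maximalIdeal R' := hgen' ▸ Ideal.subset_span (by simp)
  have ham : a ∈ maximalIdeal R := by
    have h : φ a ∈ maximalIdeal R' := by
      have : φ a = wplus - w' := by rw [hwplus]; ring
      rw [this]; exact Ideal.sub_mem _ hwplusm hw'm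
    rw [mem_maximalIdeal, mem_nonunits_iff] at h ⊢
    exact fun ha => h (ha.map φ)
  -- the `u`-chart: `𝔪 R' = (φ u)`
  have hmapφ : (maximalIdeal R).map φ = Ideal.span {φ u} := by
    apply le_antisymm
    · rw [← hgenR, Ideal.map_span, Ideal.span_le]
      rintro _ ⟨z, hz, rfl⟩
      rcases hz with rfl | rfl | rfl
      · exact Ideal.mem_span_singleton'.mpr ⟨l', by simp [hl', mul_comm]⟩
      · exact Ideal.subset_span (by simp)
      · exact Ideal.mem_span_singleton'.mpr ⟨wplus, by simp [hww, mul_comm]⟩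
    · rw [Ideal.span_singleton_le_iff_mem]
      exact Ideal.mem_map_of_mem _ (hgenR ▸ Ideal.subset_span (Or.inr (Or.inl rfl)))
  obtain ⟨t, ht⟩ : ∃ t : R', φ a = t * φ u :=
    (Ideal.mem_span_singleton'.mp (hmapφ ▸ Ideal.mem_map_of_mem φ ham)).imp fun t h => h.symm
  have hgen'' : Ideal.span {l', φ u, wplus} = maximalIdeal R' := by
    rw [hwplus, ht, ← hgen']
    have := span_triple_shear_eq l' (φ u) w' 0 t
    rwa [zero_mul, add_zero] at this
  -- (D) the completed chart: `𝔪̂ R̂' = (û)`, `û = ι' (φ u) = φ̂ (x 1)`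
  have hmapH := map_maximalIdeal_adicCompletionMap_eq_span φ hφm hmapφ
  have hû : (adicCompletionMap (maximalIdeal R) (maximalIdeal R') φ hφm) (x 1) = (algebraMap R' (AdicCompletion (maximalIdeal R') R')) (φ u) := by rw [hx1, adicCompletionMap_algebraMap]
  rw [adicCompletionMap_algebraMap] at hmapH
  have hsq : ∀ z : (AdicCompletion (maximalIdeal R) R), z ∈ maximalIdeal (AdicCompletion (maximalIdeal R) R) ^ 2 →
      ∃ s : (AdicCompletion (maximalIdeal R') R'), (adicCompletionMap (maximalIdeal R) (maximalIdeal R') φ hφm) z = (algebraMap R' (AdicCompletion (maximalIdeal R') R')) (φ u) ^ 2 * s := by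
    intro z hz
    have h1 : (adicCompletionMap (maximalIdeal R) (maximalIdeal R') φ hφm) z ∈ (maximalIdeal (AdicCompletion (maximalIdeal R) R) ^ 2).map (adicCompletionMap (maximalIdeal R) (maximalIdeal R') φ hφm) := Ideal.mem_map_of_mem _ hz
    rw [Ideal.map_pow, hmapH, Ideal.span_singleton_pow] at h1
    obtain ⟨s, hs⟩ := Ideal.mem_span_singleton'.mp h1
    exact ⟨s, by rw [← hs, mul_comm]⟩
  obtain ⟨s₀, hs₀⟩ := hsq _ hl
  obtain ⟨s₂, hs₂⟩ := hsq _ hw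
  -- the transported system
  set x' : Fin 3 → (AdicCompletion (maximalIdeal R') R') :=
    ![(algebraMap R' (AdicCompletion (maximalIdeal R') R')) l' + s₀ * (algebraMap R' (AdicCompletion (maximalIdeal R') R')) (φ u), (algebraMap R' (AdicCompletion (maximalIdeal R') R')) (φ u), (algebraMap R' (AdicCompletion (maximalIdeal R') R')) wplus + s₂ * (algebraMap R' (AdicCompletion (maximalIdeal R') R')) (φ u)] with hx'
  have hx'0 : x' 0 = (algebraMap R' (AdicCompletion (maximalIdeal R') R')) l' + s₀ * (algebraMap R' (AdicCompletion (maximalIdeal R') R')) (φ u) := rfl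
  have hx'1 : x' 1 = (algebraMap R' (AdicCompletion (maximalIdeal R') R')) (φ u) := rfl
  have hx'2 : x' 2 = (algebraMap R' (AdicCompletion (maximalIdeal R') R')) wplus + s₂ * (algebraMap R' (AdicCompletion (maximalIdeal R') R')) (φ u) := rfl
  have h₀ : (adicCompletionMap (maximalIdeal R) (maximalIdeal R') φ hφm) (x 0) = (adicCompletionMap (maximalIdeal R) (maximalIdeal R') φ hφm) (x 1) * x' 0 := by
    have : x 0 = (algebraMap R (AdicCompletion (maximalIdeal R) R)) l + (x 0 - (algebraMap R (AdicCompletion (maximalIdeal R) R)) l) := by ring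
    rw [hû, hx'0, this, map_add, hs₀, adicCompletionMap_algebraMap, hl', map_mul]; ring
  have h₂ : (adicCompletionMap (maximalIdeal R) (maximalIdeal R') φ hφm) (x 2) = (adicCompletionMap (maximalIdeal R) (maximalIdeal R') φ hφm) (x 1) * x' 2 := by
    have : x 2 = (algebraMap R (AdicCompletion (maximalIdeal R) R)) w + (x 2 - (algebraMap R (AdicCompletion (maximalIdeal R) R)) w) := by ring
    rw [hû, hx'2, this, map_add, hs₂, adicCompletionMap_algebraMap, hww, map_mul]; ring
  have h₁ : x' 1 = (adicCompletionMap (maximalIdeal R) (maximalIdeal R') φ hφm) (x 1) := by rw [hû, hx'1]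
  have hgenB' : Ideal.span {x' 0, x' 1, x' 2} = maximalIdeal (AdicCompletion (maximalIdeal R') R') := by
    rw [hx'0, hx'1, hx'2, span_triple_shear_eq, hmB, ← hgen'', Ideal.map_span, Set.image_insert_eq,
      Set.image_insert_eq, Set.image_singleton]
  have hgenB'r := span_range_eq_of_span_triple x' hgenB'
  -- (E) the weak transform in the completed chain
  have hJ' : I'.map (algebraMap R' (AdicCompletion (maximalIdeal R') R')) = ((I.map (algebraMap R (AdicCompletion (maximalIdeal R) R))).map (adicCompletionMap (maximalIdeal R) (maximalIdeal R') φ hφm)).colon {(adicCompletionMap (maximalIdeal R) (maximalIdeal R') φ hφm) (x 1) ^ μ} := by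
    rw [hx1]; exact weakTransform_adicCompletion_of_eq φ hφm hI
  -- (F) the polygon invariants transported
  have hprep' : ∀ B, PreparedUpTo x' (I'.map (algebraMap R' (AdicCompletion (maximalIdeal R') R'))) μ B := by
    intro B
    have h := preparedUpTo_colon (adicCompletionMap (maximalIdeal R) (maximalIdeal R') φ hφm) h₁ h₀ h₂ hgenx hdimA hgenB' hdimB hψ hIμA
      (show μ.factorial ≤ B + μ.factorial by omega) (hprep (B + μ.factorial))
    rw [Nat.add_sub_cancel, ← hJ'] at h
    exact h
  have hne' : (pts x' (I'.map (algebraMap R' (AdicCompletion (maximalIdeal R') R'))) μ).Nonempty := by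
    have h := pts_colon_nonempty (adicCompletionMap (maximalIdeal R) (maximalIdeal R') φ hφm) h₁ h₀ h₂ hgenx hdimA hgenB' hdimB hIμA hne hδ
    rw [← hJ'] at h
    exact h
  -- a monic element survives
  have hmon' : HasMonic x' (I'.map (algebraMap R' (AdicCompletion (maximalIdeal R') R'))) μ := by
    obtain ⟨g, hgJ, hg⟩ := SetLike.not_le_iff_exists.mp hIneA
    obtain ⟨f, hfu, hgf⟩ := exists_monic_of_lt_deltaS x hgenx hdimA hIμA hδ hgJ hg
    obtain ⟨g', hg'⟩ := exists_eq_pow_mul_of_mem_pow (adicCompletionMap (maximalIdeal R) (maximalIdeal R') φ hφm) h₀ h₂ hgenx (hIμA hgJ)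
    have hg'J : g' ∈ I'.map (algebraMap R' (AdicCompletion (maximalIdeal R') R')) := by
      rw [hJ', Submodule.mem_colon_singleton, smul_eq_mul, mul_comm, ← hg']
      exact Ideal.mem_map_of_mem _ hgJ
    have hφle : (maximalIdeal (AdicCompletion (maximalIdeal R) R)).map (adicCompletionMap (maximalIdeal R) (maximalIdeal R') φ hφm) ≤ Ideal.span {x' 1, x' 2} := by
      rw [hmapH, hx'1]
      exact Ideal.span_mono (by simp)
    exact hasMonic_of_monic_of_chart (adicCompletionMap (maximalIdeal R) (maximalIdeal R') φ hφm) (c := x) (c' := x') hgenB' hdimB (j := 1) (Or.inl rfl) h₁ h₀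
      hφle hIμB hgf (hfu.map _) hg' hg'J
  -- `τ = 1` for `x'` (from the `R'`-label `(l', φ u, w₊)`, completion invariance and rsop invariance)
  have hτx' : hironakaTauAt x' (I'.map (algebraMap R' (AdicCompletion (maximalIdeal R') R'))) μ = 1 := by
    set c' : Fin 3 → R' := ![l', φ u, wplus] with hc'
    have hgc' : Ideal.span {c' 0, c' 1, c' 2} = maximalIdeal R' := hgen''
    have h1 := hironakaTauAt_map_adicCompletion c' hgc' hdim' hIμ'
    rw [hτ' c' hgc'] at h1
    have hgc'ι : Ideal.span (Set.range (fun i => (algebraMap R' (AdicCompletion (maximalIdeal R') R')) (c' i))) = maximalIdeal (AdicCompletion (maximalIdeal R') R') :=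
      span_range_algebraMap_adicCompletion_eq_maximalIdeal (span_range_eq_of_span_triple c' hgc')
    rw [← h1]
    exact hironakaTauAt_eq_of_rsop hfrB hgc'ι hgenB'r _ μ
  have hδ' : μ.factorial < deltaS x' (I'.map (algebraMap R' (AdicCompletion (maximalIdeal R') R'))) μ := by
    have hvp := vPrepared_of_preparedUpTo x' hgenB' hdimB hIμB hne' (le_refl _)
      (hprep' (alphaS x' (I'.map (algebraMap R' (AdicCompletion (maximalIdeal R') R'))) μ))
    exact lt_deltaS_of_preparedUpTo_of_hironakaTauAt_eq_one x' hgenB' hdimB hIμB hne' hτx' hmon' hvp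
      (Nat.le_add_left _ _) (hprep' (alphaS x' (I'.map (algebraMap R' (AdicCompletion (maximalIdeal R') R'))) μ + μ.factorial))
  refine ⟨x', hx'1, hgenB', h₀, h₂, hprep', hne', hδ', hmon', fun w₁ w₁' k hw₁ hk => ?_⟩
  -- (G) the approximation of `ŵ'` by the shear-lifted parameter loses one order
  have hûne : (algebraMap R' (AdicCompletion (maximalIdeal R') R')) (φ u) ≠ 0 := ne_zero_of_span_triple hdimB hgenB'
  have h1 : (adicCompletionMap (maximalIdeal R) (maximalIdeal R') φ hφm) (x 2 - (algebraMap R (AdicCompletion (maximalIdeal R) R)) w₁) ∈ (maximalIdeal (AdicCompletion (maximalIdeal R) R) ^ (k + 1)).map (adicCompletionMap (maximalIdeal R) (maximalIdeal R') φ hφm) := Ideal.mem_map_of_mem _ hk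
  rw [Ideal.map_pow, hmapH, Ideal.span_singleton_pow] at h1
  obtain ⟨r, hr⟩ := Ideal.mem_span_singleton'.mp h1
  have h3 : (algebraMap R' (AdicCompletion (maximalIdeal R') R')) (φ u) * (x' 2 - (algebraMap R' (AdicCompletion (maximalIdeal R') R')) w₁' - (algebraMap R' (AdicCompletion (maximalIdeal R') R')) (φ u) ^ k * r) = 0 := by
    have e1 : (adicCompletionMap (maximalIdeal R) (maximalIdeal R') φ hφm) (x 2) = (algebraMap R' (AdicCompletion (maximalIdeal R') R')) (φ u) * x' 2 := by rw [← hû]; exact h₂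
    have e2 : (adicCompletionMap (maximalIdeal R) (maximalIdeal R') φ hφm) ((algebraMap R (AdicCompletion (maximalIdeal R) R)) w₁) = (algebraMap R' (AdicCompletion (maximalIdeal R') R')) (φ u) * (algebraMap R' (AdicCompletion (maximalIdeal R') R')) w₁' := by
      rw [adicCompletionMap_algebraMap, hw₁, map_mul]
    rw [map_sub, e1, e2] at hr
    rw [mul_sub, mul_sub, ← hr]; ring
  rcases mul_eq_zero.mp h3 with h | h
  · exact absurd h hûne
  · have : x' 2 - (algebraMap R' (AdicCompletion (maximalIdeal R') R')) w₁' = (algebraMap R' (AdicCompletion (maximalIdeal R') R')) (φ u) ^ k * r := sub_eq_zero.mp h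
    rw [this]
    refine Ideal.mul_mem_right _ _ (Ideal.pow_mem_pow ?_ k)
    rw [← hx'1, ← hgenB']; exact Ideal.subset_span (by simp)

end PointStep

end Literature.AlgebraicGeometry.Resolution

end
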